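import Summits.QuantumFields.YangMills.Theorems.BalabanUVNodesPortS1Sect5AtRecord

/-!
# NODE O port, row PT-A-2 — F1′ REPAIR, PART 1: the GAUGE and EUCLIDEAN (translation ∕ coordinate-reflection) on-domain rows of FILES `…Sect5GaugeOn ∕ …Sect5EuclOnAx` RE-KEYED to a
# small-field domain family of FREE radius — `domAltOfRecord F N νD K j = {V | PlaqSmall νD.ε₀ V}` for an arbitrary numerics record `νD` — instead of `domAltOfRecord F N θ₀.ν K j`

CITATION HEADER.  [I] = [Balaban1987RG1]: (1.6) p. 261, (1.19) p. 263, (2.9) p. 266, (2.16)–(2.18) p. 269, (1.2) p. 260, (0.11) p. 253, (2.3) p. 265; [B11] = [Balaban1985Variational]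
Thm 1 p. 279; [B7] = [Balaban1985Averaging] Prop. 2 (53) p. 26.  Porter PT-A-2 (`ymgap-nodeO-port-PTA-2`), `--supports stmt-QuantumFields-27930 --as helper`.
WHY THE RE-KEYING IS SOUND.  The re-centred cut-off `chiβOfRecord₁₃Ax F N θ₀ = chiFixed29Ax F N θ₀.ν θ₀.ε₂₉` reads the numerics `θ₀.ν` ONLY through `critCfgOfRecord F N θ₀.ν`, i.e. through
the regularity radius `θ₀.ν.εreg` of [B11]'s minimiser (`SmallFieldChi29OfRecord` :77, `SmallFieldChi29AxOfRecord` :59∕:142∕:147); the DOMAINS on which gen 2∕3 asked gauge ∕ Euclidean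
invariance, [B11] existence–uniqueness, (F7a), (F7a-supp) and the nestings are a SEPARATE datum — dag-n09-w4's engine `invOn_effActionHT_of_stepsOn_on` takes an arbitrary open,
gauge-stable family `D`.  Every proof below is the gen-2∕3 proof VERBATIM with `domAltOfRecord F N θ₀.ν ↦ domAltOfRecord F N νD` in the domain slots (the radius `θ₀.ν.εreg` of the
[B11] rows and `critCfgOfRecord F N θ₀.ν` are untouched); the numeric guards now read `νD.ε₀` (`0 ≤ νD.ε₀`, `((dL)²∕4)·νD.ε₀ < δ_Fed`, `2ε ≤ νD.ε₀·L²`), all satisfiable for small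
`νD.ε₀`.  At `θ₀ := thetaFill F a₀ ε₂₉` the originals' radius `θ₀.ν.ε₀` is PINNED TO THE LITERAL `1` (a `Φf`-unread fill) and the Federbush clause is false (referee ref-H F1,
2026-08-31): the originals stay in the tree (true, vacuous there, unused).
WHAT IS PROVED (0 sorry, 0 def): the primed twins `chiβOfRecord₁₃Ax_gaugeAct_liftTransf_of_mem_domAlt'`, `…_ae_on'`, `invOn_effActionHT_recordAx_of_stepsOn'`, `mergedTermT_gaugeAct_on_recordAx'`
(gauge, [I] (1.19)∕(2.16)); `chiβOfRecord₁₃Ax_translate_of_mem_domAlt'`, `chiβOfRecord₁₃Ax_creflect_of_mem_domAlt'`, `invOn_effActionHT_recordAx_translate'`, `invOn_effActionHT_recordAx_creflect'`,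
`mergedTermT_translate_on_recordAx'`, `mergedTermT_creflect_on_recordAx'` ([I] (2.17)–(2.18)).
HONEST FRAMING.  A re-keying of displayed rows (bookkeeping over dag-n09's engines); nothing of Bałaban's estimates asserted, ported or discharged; the rows REMAIN displayed (N-lane ∕ [B11]
suppliers); 27930 signed-open (⁸-Ax-LR4), no claim held; finite 𝕋⁴ at fixed ε — NOT continuum∕OS∕Clay; the Yang–Mills mass gap is NOT proved by any of this.
-/

noncomputable section

open scoped Matrix.Norms.L2Operator Topology

namespace Summit.QuantumFields.YangMills.Theorems.BalabanUVNodesPortS1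

open Filter MeasureTheory
open Literature.MathematicalPhysics.QuantumFieldTheory.Balaban1983to89
open Literature.MathematicalPhysics.QuantumFieldTheory.Balaban1983to89.Node00
open Literature.MathematicalPhysics.QuantumFieldTheory.Balaban1983to89.ExpMeanLog (deltaSU)
open T4Continuum (T4Family)
open B12Eq019ActionBody (integrand integrand_apply wilsonTerm_apply)
open B12RTGaugeInvariance254 (liftTransf)
open GaugeField (gaugeAct)
open B12ContinuousTransportInvarianceOn (isOpen_domAltOfRecord domAltOfRecord_gaugeAct_mem)
open Summit.QuantumFields.YangMills.BalabanUVNodes.N09AtRecord13SepCoPHOnDomains (invOn_effActionHT_of_stepsOn_on stepOn_TβOfRecord₁₃_of_subset_regSet_inter_of_on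
  domAltOfRecord_gaugeAct_mem_iff integrand_comp_liftAct_ae_eq_on_of_invOn)
open B16Sect1Backgrounds (iter_gaugeAct gaugeAct_gaugeAct)
open Literature.MathematicalPhysics.QuantumFieldTheory.Balaban1983to89.Node00.ZeroInput (stepOutT mergedTermT_eq_stepOut)
open BlockAveragingTwoLevel (stairHol offsetOf)
open FederbushMean (federbushSU deltaFed)
open Summit.QuantumFields.YangMills.BalabanUVNodes.N09GaugeFixingTermContinuousOnAdmissible (adm_stairHol_of_plaqSmall)
open Summit.QuantumFields.YangMills.BalabanUVNodes.N09NestingOfHierAxial (hcrit_of_ukExists iterUk_mem_domAlt_of_ukExists)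

variable {F : T4Family} {N : ℕ} [NeZero N]

/-! ## §1 Gauge invariance on the free-radius domains (twins of FILE `…Sect5GaugeOn`) -/

/-- **[F1′ twin: the small-field DOMAIN family is `domAltOfRecord F · νD K ·` = `{PlaqSmall νD.ε₀}` for a FREE numerics record `νD` (only `νD.ε₀` is read); χ, radii `ν.εreg`∕`εbg`∕`ε₂₉` unchanged]** **(M1-dom) AT THE RE-CENTRED RECORD**: `χ^{Ax}_j(U^{v∘blockOf}) = χ^{Ax}_j(U)` for every level-`j` field `U` whose average lies in the small-field domain of level `j+1`,
given [B11] Thm 1's existence and uniqueness on that (gauge-stable) domain at the cut-off's radius `ν.εreg` — [Ax-2]'s hypothesis-free (M1) fed by the binder at `Ū` and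
at `Ū^v`. [cite: Balaban1987RG1, (2.9) p.266, (2.16) p.269; Balaban1985Variational, Thm 1 p.279] -/
theorem chiβOfRecord₁₃Ax_gaugeAct_liftTransf_of_mem_domAlt' (θ₀ : Stage13Params F N) (νD : Stage7Numerics) (K : ℕ) (g : ℕ → ℝ) {j : ℕ} (hj : j + 1 ≤ (F.P K).m + (F.P K).K)
    (h11 : ∀ W ∈ domAltOfRecord F N νD K (j + 1), UkExists F N K (j + 1) θ₀.ν.εreg W ∧ UniqueUkOrbit F N K (j + 1) θ₀.ν.εreg W)
    (v : GaugeTransf (F.P K) (j + 1) (SU N)) (U : GaugeField (F.P K) j (SU N)) (hU : (avOfRecord F N K j).avg U ∈ domAltOfRecord F N νD K (j + 1)) :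
    chiβOfRecord₁₃Ax F N θ₀ K g j (gaugeAct (liftTransf v) U) = chiβOfRecord₁₃Ax F N θ₀ K g j U :=
  chiFixed29Ax_gaugeAct_liftTransf θ₀.ε₂₉ hj g v U (h11 _ hU).1 (h11 _ (domAltOfRecord_gaugeAct_mem νD K (j + 1) v _ hU)).2

/-- **[F1′ twin: the small-field DOMAIN family is `domAltOfRecord F · νD K ·` = `{PlaqSmall νD.ε₀}` for a FREE numerics record `νD` (only `νD.ε₀` is read); χ, radii `ν.εreg`∕`εbg`∕`ε₂₉` unchanged]** The a.e. form over the fibres of the domain, every level `j < n ≤ K` (the engine's `hχ` row). [cite: Balaban1987RG1, (2.9) p.266, (2.16) p.269; Balaban1985Variational, Thm 1 p.279] -/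
theorem chiβOfRecord₁₃Ax_gaugeAct_liftTransf_ae_on' (θ₀ : Stage13Params F N) (νD : Stage7Numerics) (K : ℕ) (g : ℕ → ℝ) {n : ℕ} (hn : n ≤ K)
    (h11 : ∀ j < n, ∀ W ∈ domAltOfRecord F N νD K (j + 1), UkExists F N K (j + 1) θ₀.ν.εreg W ∧ UniqueUkOrbit F N K (j + 1) θ₀.ν.εreg W) :
    ∀ j < n, ∀ v : GaugeTransf (F.P K) (j + 1) (SU N), ∀ᵐ U ∂(fieldMeasure (F.P K) j (SU N)),
      (avOfRecord F N K j).avg U ∈ domAltOfRecord F N νD K (j + 1) →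
        chiβOfRecord₁₃Ax F N θ₀ K g j (gaugeAct (liftTransf v) U) = chiβOfRecord₁₃Ax F N θ₀ K g j U := by
  intro j hj v
  have hj' : j + 1 ≤ (F.P K).m + (F.P K).K := by simp only [T4Continuum.T4Family.P_K]; omega
  exact Filter.Eventually.of_forall fun U hU => chiβOfRecord₁₃Ax_gaugeAct_liftTransf_of_mem_domAlt' θ₀ νD K g hj' (h11 j hj) v U hU

/-- **[F1′ twin: the small-field DOMAIN family is `domAltOfRecord F · νD K ·` = `{PlaqSmall νD.ε₀}` for a FREE numerics record `νD` (only `νD.ε₀` is read); χ, radii `ν.εreg`∕`εbg`∕`ε₂₉` unchanged]** **`A_k(V^v) = A_k(V)` ON THE DOMAINS AT THE RE-CENTRED RECORD**, every `k ≤ n ≤ K`, with bookkeeping sets `D 0 := univ`, `D (i+1) := regSetOfRecord K i ρ_i ∩ domAltOfRecord νD K (i+1)`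
(`ρ_i` the (0.19) density met at step `i`): from [B11] Thm 1 on the domains at radius `ν.εreg` (levels `< n`), (F7a-dom) «`χ^{Ax}_{i+1}` vanishes off `D (i+1)` over the fibres of
`domAlt (i+2)`» and (I19) integrability — dag-n09-w4's engine with its `hχ` row DISCHARGED by §1 and its per-step row by `stepOn_TβOfRecord₁₃_of_subset_regSet_inter_of_on`.
[cite: Balaban1987RG1, p.263, (0.13) p.254, (0.19) p.255, (2.9) p.266, (2.16) p.269; Balaban1985Variational, Thm 1 p.279] -/
theorem invOn_effActionHT_recordAx_of_stepsOn' (θ₀ : Stage13Params F N) (νD : Stage7Numerics) (K : ℕ) (g : ℕ → ℝ) {n : ℕ} (hn : n ≤ K)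
    (h11 : ∀ j < n, ∀ W ∈ domAltOfRecord F N νD K (j + 1), UkExists F N K (j + 1) θ₀.ν.εreg W ∧ UniqueUkOrbit F N K (j + 1) θ₀.ν.εreg W)
    (hχreg : ∀ i, i + 1 < n → ∀ᵐ U ∂(fieldMeasure (F.P K) (i + 1) (SU N)),
      (avOfRecord F N K (i + 1)).avg U ∈ domAltOfRecord F N νD K (i + 2) →
        U ∉ regSetOfRecord F N K i (betaInputOfRecord F N (TβOfRecord₁₃ F N) (chiβOfRecord₁₃Ax F N θ₀) K g i) ∩ domAltOfRecord F N νD K (i + 1) →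
          chiβOfRecord₁₃Ax F N θ₀ K g (i + 1) U = 0)
    (hint : ∀ j < n, Integrable (betaInputOfRecord F N (TβOfRecord₁₃ F N) (chiβOfRecord₁₃Ax F N θ₀) K g j) (fieldMeasure (F.P K) j (SU N))) :
    ∀ k ≤ n, ∀ (v : GaugeTransf (F.P K) k (SU N)) (V : GaugeField (F.P K) k (SU N)),
      V ∈ Nat.rec (motive := fun j => Set (GaugeField (F.P K) j (SU N))) Set.univ
          (fun i _ => regSetOfRecord F N K i (betaInputOfRecord F N (TβOfRecord₁₃ F N) (chiβOfRecord₁₃Ax F N θ₀) K g i) ∩ domAltOfRecord F N νD K (i + 1)) k →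
        effActionHT F N (TβOfRecord₁₃ F N) (chiβOfRecord₁₃Ax F N θ₀) K g k (gaugeAct v V) = effActionHT F N (TβOfRecord₁₃ F N) (chiβOfRecord₁₃Ax F N θ₀) K g k V := by
  have hn' : n ≤ (F.P K).m + (F.P K).K := hn.trans (by simp only [T4Continuum.T4Family.P_K]; omega)
  refine invOn_effActionHT_of_stepsOn_on (TβOfRecord₁₃ F N) (chiβOfRecord₁₃Ax F N θ₀) K g hn' (fun j => domAltOfRecord F N νD K j) _
    (chiβOfRecord₁₃Ax_gaugeAct_liftTransf_ae_on' θ₀ νD K g hn h11) ?_ ?_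
  · intro j hj
    cases j with
    | zero => exact Filter.Eventually.of_forall fun U _ hU => absurd (Set.mem_univ U) hU
    | succ i => exact hχreg i hj
  · intro j hj hlift
    exact stepOn_TβOfRecord₁₃_of_subset_regSet_inter_of_on F N (lt_of_lt_of_le hj hn) _ (hint j hj) (isOpen_domAltOfRecord νD K (j + 1))
      (fun v V => domAltOfRecord_gaugeAct_mem_iff νD K (j + 1) v V) subset_rfl hlift

/-- **[F1′ twin: the small-field DOMAIN family is `domAltOfRecord F · νD K ·` = `{PlaqSmall νD.ε₀}` for a FREE numerics record `νD` (only `νD.ε₀` is read); χ, radii `ν.εreg`∕`εbg`∕`ε₂₉` unchanged]** **`𝓝_{k+1}(W^v) = 𝓝_{k+1}(W)` AT THE RE-CENTRED RECORD ON THE DOMAIN** (`k + 1 ≤ K`): for `W ∈ regSetOfRecord K k ρ_k ∩ domAltOfRecord νD K (k+1)`, given §2's rows at levels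
`≤ k`, the NESTING «`Ū^k U_{k+1}(W) ∈ D k`» and [B11] Thm 1 for `W`, `W^v` at the minimiser's radius `ε` — the `A_k`-row and the image row DISCHARGED by §2 ∕ the step
supplier. [cite: Balaban1987RG1, (1.6) p.261, (1.19) p.263, (2.16) p.269, (1.2) p.260; Balaban1985Variational, Thm 1 p.279] -/
theorem mergedTermT_gaugeAct_on_recordAx' (θ₀ : Stage13Params F N) (νD : Stage7Numerics) (ε : ℝ) (K : ℕ) (g : ℕ → ℝ) {k : ℕ} (hk : k + 1 ≤ K)
    (h11 : ∀ j < k + 1, ∀ W ∈ domAltOfRecord F N νD K (j + 1), UkExists F N K (j + 1) θ₀.ν.εreg W ∧ UniqueUkOrbit F N K (j + 1) θ₀.ν.εreg W)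
    (hχreg : ∀ i, i + 1 < k + 1 → ∀ᵐ U ∂(fieldMeasure (F.P K) (i + 1) (SU N)),
      (avOfRecord F N K (i + 1)).avg U ∈ domAltOfRecord F N νD K (i + 2) →
        U ∉ regSetOfRecord F N K i (betaInputOfRecord F N (TβOfRecord₁₃ F N) (chiβOfRecord₁₃Ax F N θ₀) K g i) ∩ domAltOfRecord F N νD K (i + 1) →
          chiβOfRecord₁₃Ax F N θ₀ K g (i + 1) U = 0)
    (hint : ∀ j < k + 1, Integrable (betaInputOfRecord F N (TβOfRecord₁₃ F N) (chiβOfRecord₁₃Ax F N θ₀) K g j) (fieldMeasure (F.P K) j (SU N)))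
    (v : GaugeTransf (F.P K) (k + 1) (SU N)) {W : GaugeField (F.P K) (k + 1) (SU N)}
    (hWD : W ∈ regSetOfRecord F N K k (betaInputOfRecord F N (TβOfRecord₁₃ F N) (chiβOfRecord₁₃Ax F N θ₀) K g k) ∩ domAltOfRecord F N νD K (k + 1))
    (hnest : Averaging.iter (avOfRecord F N K) k (Uk F N K (k + 1) ε W) ∈
      Nat.rec (motive := fun j => Set (GaugeField (F.P K) j (SU N))) Set.univ
        (fun i _ => regSetOfRecord F N K i (betaInputOfRecord F N (TβOfRecord₁₃ F N) (chiβOfRecord₁₃Ax F N θ₀) K g i) ∩ domAltOfRecord F N νD K (i + 1)) k)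
    (hW : UkExists F N K (k + 1) ε W) (hu : UniqueUkOrbit F N K (k + 1) ε (gaugeAct v W)) :
    mergedTermT F N (TβOfRecord₁₃ F N) (chiβOfRecord₁₃Ax F N θ₀) ε K g k (gaugeAct v W) =
      mergedTermT F N (TβOfRecord₁₃ F N) (chiβOfRecord₁₃Ax F N θ₀) ε K g k W := by
  have hk' : k + 1 ≤ (F.P K).m + (F.P K).K := hk.trans (by simp only [T4Continuum.T4Family.P_K]; omega)
  have hA := invOn_effActionHT_recordAx_of_stepsOn' θ₀ νD K g hk h11 hχreg hint
  -- the level-`k` density is lift-invariant a.e. over the fibres of the domain, hence its image is invariant on `D (k+1)`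
  have hρ : ∀ v' : GaugeTransf (F.P K) (k + 1) (SU N), ∀ᵐ U ∂(fieldMeasure (F.P K) k (SU N)),
      (avOfRecord F N K k).avg U ∈ domAltOfRecord F N νD K (k + 1) →
        betaInputOfRecord F N (TβOfRecord₁₃ F N) (chiβOfRecord₁₃Ax F N θ₀) K g k (gaugeAct (liftTransf v') U) =
          betaInputOfRecord F N (TβOfRecord₁₃ F N) (chiβOfRecord₁₃Ax F N θ₀) K g k U := fun v' =>
    integrand_comp_liftAct_ae_eq_on_of_invOn
      (chiβOfRecord₁₃Ax_gaugeAct_liftTransf_ae_on' θ₀ νD K g hk h11 k (Nat.lt_succ_self k))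
      (B12EffectiveActionInvarianceT.gfOfRecord_liftInvariant F N K hk')
      (by
        cases k with
        | zero => exact Filter.Eventually.of_forall fun U _ hU => absurd (Set.mem_univ U) hU
        | succ i => exact hχreg i (by omega))
      (fun w U hU => hA k (Nat.le_succ k) (liftTransf w) U hU) (g k) v'
  have hTon := stepOn_TβOfRecord₁₃_of_subset_regSet_inter_of_on F N hk _ (hint k (Nat.lt_succ_self k)) (isOpen_domAltOfRecord νD K (k + 1))
    (fun v V => domAltOfRecord_gaugeAct_mem_iff νD K (k + 1) v V) subset_rfl hρ
  exact mergedTermT_gaugeAct_on_of_mem F N (TβOfRecord₁₃ F N) (chiβOfRecord₁₃Ax F N θ₀) ε g hk' hTon (fun w U hU => hA k (Nat.le_succ k) w U hU) v hWD hnest hW hu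

/-! ## §2 Translations and coordinate reflections: the χ-rows (twins of FILE `…Sect5EuclOnAx` §2) -/

/-- **[F1′ twin: the small-field DOMAIN family is `domAltOfRecord F · νD K ·` = `{PlaqSmall νD.ε₀}` for a FREE numerics record `νD` (only `νD.ε₀` is read); χ, radii `ν.εreg`∕`εbg`∕`ε₂₉` unchanged]** **`χ^{Ax}_j(τ_{La} U) = χ^{Ax}_j(U)`** for every `U` whose average lies in the small-field domain of level `j+1` (translation-stable), given [B11] Thm 1 on that domain at the
cut-off's radius (FILE E2's row fed at `Ū` and `τ_a Ū`). [cite: Balaban1987RG1, (2.17) p.269, (2.9) p.266; Balaban1985Variational, Thm 1 p.279] -/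
theorem chiβOfRecord₁₃Ax_translate_of_mem_domAlt' (θ₀ : Stage13Params F N) (νD : Stage7Numerics) (K : ℕ) (g : ℕ → ℝ) {j : ℕ} (hj : j + 1 ≤ (F.P K).m + (F.P K).K)
    (h11 : ∀ W ∈ domAltOfRecord F N νD K (j + 1), UkExists F N K (j + 1) θ₀.ν.εreg W ∧ UniqueUkOrbit F N K (j + 1) θ₀.ν.εreg W)
    (a : Site (F.P K) (j + 1)) (U : GaugeField (F.P K) j (SU N)) (hU : (avOfRecord F N K j).avg U ∈ domAltOfRecord F N νD K (j + 1)) :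
    chiβOfRecord₁₃Ax F N θ₀ K g j (U.translate (Site.scale a)) = chiβOfRecord₁₃Ax F N θ₀ K g j U :=
  chiFixed29Ax_translate θ₀.ε₂₉ hj g a U (h11 _ hU).1
    (h11 _ ((mem_domAltOfRecord_iff F N νD K (j + 1) _).2
      ((B12RegularClassInvariance263.plaqSmall_translate_iff νD.ε₀ a _).2 ((mem_domAltOfRecord_iff F N νD K (j + 1) _).1 hU)))).2

/-- **[F1′ twin: the small-field DOMAIN family is `domAltOfRecord F · νD K ·` = `{PlaqSmall νD.ε₀}` for a FREE numerics record `νD` (only `νD.ε₀` is read); χ, radii `ν.εreg`∕`εbg`∕`ε₂₉` unchanged]** **`χ^{Ax}_j(c_ρ U) = χ^{Ax}_j(U)`** for every `U` whose average lies in the small-field domain of level `j+1` (reflection-stable), given [B11] Thm 1 there.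
[cite: Balaban1987RG1, (2.17)-(2.18) p.269, (2.9) p.266; Balaban1985Variational, Thm 1 p.279] -/
theorem chiβOfRecord₁₃Ax_creflect_of_mem_domAlt' (θ₀ : Stage13Params F N) (νD : Stage7Numerics) (K : ℕ) (g : ℕ → ℝ) {j : ℕ} (hj : j + 1 ≤ (F.P K).m + (F.P K).K)
    (h11 : ∀ W ∈ domAltOfRecord F N νD K (j + 1), UkExists F N K (j + 1) θ₀.ν.εreg W ∧ UniqueUkOrbit F N K (j + 1) θ₀.ν.εreg W)
    (ρ : Fin (F.P K).d) (U : GaugeField (F.P K) j (SU N)) (hU : (avOfRecord F N K j).avg U ∈ domAltOfRecord F N νD K (j + 1)) :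
    chiβOfRecord₁₃Ax F N θ₀ K g j (U.creflect ρ) = chiβOfRecord₁₃Ax F N θ₀ K g j U :=
  chiFixed29Ax_creflect θ₀.ε₂₉ hj g ρ U (h11 _ hU).1
    (h11 _ ((mem_domAltOfRecord_iff F N νD K (j + 1) _).2
      ((B12RegularClassInvariance263.plaqSmall_creflect_iff νD.ε₀ ρ _).2 ((mem_domAltOfRecord_iff F N νD K (j + 1) _).1 hU)))).2

section Rows

variable (θ₀ : Stage13Params F N) (νD : Stage7Numerics) (K : ℕ) (g : ℕ → ℝ)

/-! ## §3 `A_k` and `𝓝_{k+1}` under translations ∕ reflections on the free-radius domains (twins of FILE `…Sect5EuclOnAx` §3) -/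

/-- **[F1′ twin: the small-field DOMAIN family is `domAltOfRecord F · νD K ·` = `{PlaqSmall νD.ε₀}` for a FREE numerics record `νD` (only `νD.ε₀` is read); χ, radii `ν.εreg`∕`εbg`∕`ε₂₉` unchanged]** **`A_k(τ_a U) = A_k(U)` ON `domAlt_k` FOR EVERY LEVEL-`k` LATTICE VECTOR `a`, all `k ≤ n ≤ K`, AT THE RE-CENTRED RECORD** (the induction carries ALL vectors at each level,
the step linking `a` at level `j+1` to `L·a` at level `j`), from [B11] Thm 1 on the domains (levels `< n`), (F7a) «`domAlt_{i+1} ⊆ regSet_i(ρ_i)`», (F7a-supp) «`χ^{Ax}_j = 0` off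
`domAlt_j` a.e. over the fibres of `domAlt_{j+1}`» and (I19). [cite: Balaban1987RG1, p.263, (2.17) p.269, (0.13) p.254, (0.19) p.255; Balaban1985Variational, Thm 1 p.279] -/
theorem invOn_effActionHT_recordAx_translate' {n : ℕ} (hn : n ≤ K)
    (h11 : ∀ j < n, ∀ W ∈ domAltOfRecord F N νD K (j + 1), UkExists F N K (j + 1) θ₀.ν.εreg W ∧ UniqueUkOrbit F N K (j + 1) θ₀.ν.εreg W)
    (hF7a : ∀ j < n, domAltOfRecord F N νD K (j + 1) ⊆
      regSetOfRecord F N K j (betaInputOfRecord F N (TβOfRecord₁₃ F N) (chiβOfRecord₁₃Ax F N θ₀) K g j))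
    (hsupp : ∀ j < n, ∀ᵐ U ∂(fieldMeasure (F.P K) j (SU N)), (avOfRecord F N K j).avg U ∈ domAltOfRecord F N νD K (j + 1) →
      U ∉ domAltOfRecord F N νD K j → chiβOfRecord₁₃Ax F N θ₀ K g j U = 0)
    (hint : ∀ j < n, Integrable (betaInputOfRecord F N (TβOfRecord₁₃ F N) (chiβOfRecord₁₃Ax F N θ₀) K g j) (fieldMeasure (F.P K) j (SU N))) :
    ∀ k ≤ n, ∀ (a : Site (F.P K) k) (U : GaugeField (F.P K) k (SU N)), U ∈ domAltOfRecord F N νD K k →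
      effActionHT F N (TβOfRecord₁₃ F N) (chiβOfRecord₁₃Ax F N θ₀) K g k (U.translate a) =
        effActionHT F N (TβOfRecord₁₃ F N) (chiβOfRecord₁₃Ax F N θ₀) K g k U := by
  have hn' : n ≤ (F.P K).m + (F.P K).K := hn.trans (by simp only [T4Continuum.T4Family.P_K]; omega)
  refine invOn_effActionHT_of_stepsOn_family_on F N (TβOfRecord₁₃ F N) (chiβOfRecord₁₃Ax F N θ₀) K g n
    (fun j => domAltOfRecord F N νD K j) (fun j => domAltOfRecord F N νD K j) (I := fun j => Site (F.P K) j) (fun j a => Site.scale a)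
    (fun j a U => U.translate a)
    (fun a U => (wilsonAction_invariant_generators F N (K := K) 1).1 a U) (fun j hj a => ?_) hsupp (fun j hj a U _ => ?_) (fun j hj a hρ V hV => ?_)
  · have hj' : j + 1 ≤ (F.P K).m + (F.P K).K := (Nat.succ_le_of_lt hj).trans hn'
    exact Filter.Eventually.of_forall fun U hU => chiβOfRecord₁₃Ax_translate_of_mem_domAlt' θ₀ νD K g hj' (h11 j hj) a U hU
  · have hj' : j + 1 ≤ (F.P K).m + (F.P K).K := (Nat.succ_le_of_lt hj).trans hn'
    exact B12GaugeFixInvariance269.gaugeFixFn_translate FederbushMean.federbushSU hj' a U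
  · exact TcanOfRecord_translate_of_mem_regSet_inter_of_on (lt_of_lt_of_le hj hn) (hint j hj) a (isOpen_domAltOfRecord νD K (j + 1))
      (fun W => translate_mem_domAltOfRecord_iff K νD (j + 1) a W) hρ ⟨hF7a j hj hV, hV⟩

/-- **[F1′ twin: the small-field DOMAIN family is `domAltOfRecord F · νD K ·` = `{PlaqSmall νD.ε₀}` for a FREE numerics record `νD` (only `νD.ε₀` is read); χ, radii `ν.εreg`∕`εbg`∕`ε₂₉` unchanged]** **`A_k(c_ρ U) = A_k(U)` ON `domAlt_k`, all `k ≤ n ≤ K`, AT THE RE-CENTRED RECORD**, from the same rows. [cite: Balaban1987RG1, p.263, (2.17)-(2.18) p.269, (0.13) p.254; Balaban1985Variational, Thm 1 p.279] -/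
theorem invOn_effActionHT_recordAx_creflect' {n : ℕ} (hn : n ≤ K) (ρ : Fin (F.P K).d)
    (h11 : ∀ j < n, ∀ W ∈ domAltOfRecord F N νD K (j + 1), UkExists F N K (j + 1) θ₀.ν.εreg W ∧ UniqueUkOrbit F N K (j + 1) θ₀.ν.εreg W)
    (hF7a : ∀ j < n, domAltOfRecord F N νD K (j + 1) ⊆
      regSetOfRecord F N K j (betaInputOfRecord F N (TβOfRecord₁₃ F N) (chiβOfRecord₁₃Ax F N θ₀) K g j))
    (hsupp : ∀ j < n, ∀ᵐ U ∂(fieldMeasure (F.P K) j (SU N)), (avOfRecord F N K j).avg U ∈ domAltOfRecord F N νD K (j + 1) →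
      U ∉ domAltOfRecord F N νD K j → chiβOfRecord₁₃Ax F N θ₀ K g j U = 0)
    (hint : ∀ j < n, Integrable (betaInputOfRecord F N (TβOfRecord₁₃ F N) (chiβOfRecord₁₃Ax F N θ₀) K g j) (fieldMeasure (F.P K) j (SU N))) :
    ∀ k ≤ n, ∀ U, U ∈ domAltOfRecord F N νD K k →
      effActionHT F N (TβOfRecord₁₃ F N) (chiβOfRecord₁₃Ax F N θ₀) K g k (U.creflect ρ) =
        effActionHT F N (TβOfRecord₁₃ F N) (chiβOfRecord₁₃Ax F N θ₀) K g k U := by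
  have hn' : n ≤ (F.P K).m + (F.P K).K := hn.trans (by simp only [T4Continuum.T4Family.P_K]; omega)
  have h := invOn_effActionHT_of_stepsOn_family_on F N (TβOfRecord₁₃ F N) (chiβOfRecord₁₃Ax F N θ₀) K g n
    (fun j => domAltOfRecord F N νD K j) (fun j => domAltOfRecord F N νD K j) (I := fun _ => Fin (F.P K).d) (fun _ ρ' => ρ')
    (fun _ ρ' U => U.creflect ρ')
    (fun ρ' U => (wilsonAction_invariant_generators F N (K := K) 1).2.2 ρ' U) (fun j hj ρ' => ?_) hsupp (fun j hj ρ' U _ => ?_) (fun j hj ρ' hρ V hV => ?_)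
  · exact fun k hk U hU => h k hk ρ U hU
  · have hj' : j + 1 ≤ (F.P K).m + (F.P K).K := (Nat.succ_le_of_lt hj).trans hn'
    exact Filter.Eventually.of_forall fun U hU => chiβOfRecord₁₃Ax_creflect_of_mem_domAlt' θ₀ νD K g hj' (h11 j hj) ρ' U hU
  · have hj' : j + 1 ≤ (F.P K).m + (F.P K).K := (Nat.succ_le_of_lt hj).trans hn'
    exact B12GaugeFixInvariance269.gaugeFixFn_creflect FederbushMean.federbushSU hj' ρ' U
  · exact TcanOfRecord_creflect_of_mem_regSet_inter_of_on (lt_of_lt_of_le hj hn) (hint j hj) ρ' (isOpen_domAltOfRecord νD K (j + 1))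
      (fun W => creflect_mem_domAltOfRecord_iff K νD (j + 1) ρ' W) hρ ⟨hF7a j hj hV, hV⟩

/-- **[F1′ twin: the small-field DOMAIN family is `domAltOfRecord F · νD K ·` = `{PlaqSmall νD.ε₀}` for a FREE numerics record `νD` (only `νD.ε₀` is read); χ, radii `ν.εreg`∕`εbg`∕`ε₂₉` unchanged]** **`𝓝_{k+1}(τ_a W) = 𝓝_{k+1}(W)` AT THE RE-CENTRED RECORD for `W ∈ domAlt_{k+1}`** (`k + 1 ≤ K`): rows — [B11] on the domains (levels `≤ k+1`, radius `ν.εreg`), (F7a) at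
levels `≤ k`, (F7a-supp), (I19), the NESTING «`Ū^k U_{k+1}(W) ∈ domAlt_k`», and [B11] at `W`, `τ_a W` (radius `ε`); the `A_k`-rows on `domAlt_k` (gauge: FILE `…Sect5GaugeOn` §2
with (F7a); translation: §3) are discharged inside. [cite: Balaban1987RG1, (1.6) p.261, (2.17) p.269, p.263, (1.2) p.260; Balaban1985Variational, Thm 1 p.279] -/
theorem mergedTermT_translate_on_recordAx' (ε : ℝ) {k : ℕ} (hk : k + 1 ≤ K) (a : Site (F.P K) (k + 1))
    (h11 : ∀ j < k + 1, ∀ W ∈ domAltOfRecord F N νD K (j + 1), UkExists F N K (j + 1) θ₀.ν.εreg W ∧ UniqueUkOrbit F N K (j + 1) θ₀.ν.εreg W)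
    (hF7a : ∀ j < k + 1, domAltOfRecord F N νD K (j + 1) ⊆
      regSetOfRecord F N K j (betaInputOfRecord F N (TβOfRecord₁₃ F N) (chiβOfRecord₁₃Ax F N θ₀) K g j))
    (hsupp : ∀ j < k + 1, ∀ᵐ U ∂(fieldMeasure (F.P K) j (SU N)), (avOfRecord F N K j).avg U ∈ domAltOfRecord F N νD K (j + 1) →
      U ∉ domAltOfRecord F N νD K j → chiβOfRecord₁₃Ax F N θ₀ K g j U = 0)
    (hint : ∀ j < k + 1, Integrable (betaInputOfRecord F N (TβOfRecord₁₃ F N) (chiβOfRecord₁₃Ax F N θ₀) K g j) (fieldMeasure (F.P K) j (SU N)))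
    {W : GaugeField (F.P K) (k + 1) (SU N)} (hWD : W ∈ domAltOfRecord F N νD K (k + 1))
    (hnest : Averaging.iter (avOfRecord F N K) k (Uk F N K (k + 1) ε W) ∈ domAltOfRecord F N νD K k)
    (hW : UkExists F N K (k + 1) ε W) (hu : UniqueUkOrbit F N K (k + 1) ε (W.translate a)) :
    mergedTermT F N (TβOfRecord₁₃ F N) (chiβOfRecord₁₃Ax F N θ₀) ε K g k (W.translate a) =
      mergedTermT F N (TβOfRecord₁₃ F N) (chiβOfRecord₁₃Ax F N θ₀) ε K g k W := by
  have hk' : k + 1 ≤ (F.P K).m + (F.P K).K := hk.trans (by simp only [T4Continuum.T4Family.P_K]; omega)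
  have hAtr := invOn_effActionHT_recordAx_translate' θ₀ νD K g hk h11 hF7a hsupp hint
  -- the gauge row of `A_k` on `domAlt_k`: FILE `…Sect5GaugeOn` §2 gives it on `regSet_{k−1} ∩ domAlt_k`, which is `domAlt_k` under (F7a)
  have hAg : ∀ (w : GaugeTransf (F.P K) k (SU N)) (U : GaugeField (F.P K) k (SU N)), U ∈ domAltOfRecord F N νD K k →
      effActionHT F N (TβOfRecord₁₃ F N) (chiβOfRecord₁₃Ax F N θ₀) K g k (gaugeAct w U) = effActionHT F N (TβOfRecord₁₃ F N) (chiβOfRecord₁₃Ax F N θ₀) K g k U := by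
    intro w U hU
    have hχreg : ∀ i, i + 1 < k + 1 → ∀ᵐ U ∂(fieldMeasure (F.P K) (i + 1) (SU N)),
        (avOfRecord F N K (i + 1)).avg U ∈ domAltOfRecord F N νD K (i + 2) →
          U ∉ regSetOfRecord F N K i (betaInputOfRecord F N (TβOfRecord₁₃ F N) (chiβOfRecord₁₃Ax F N θ₀) K g i) ∩ domAltOfRecord F N νD K (i + 1) →
            chiβOfRecord₁₃Ax F N θ₀ K g (i + 1) U = 0 := fun i hi =>
      (hsupp (i + 1) hi).mono fun U h hS hD => h hS fun hU' => hD ⟨hF7a i (by omega) hU', hU'⟩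
    have hA := invOn_effActionHT_recordAx_of_stepsOn' θ₀ νD K g hk h11 hχreg hint k (Nat.le_succ k) w U
    cases k with
    | zero => exact hA (Set.mem_univ _)
    | succ i => exact hA ⟨hF7a i (by omega) hU, hU⟩
  -- the image row at level `k` on `domAlt_{k+1}`: the density `ρ_k` is `τ_{La}`-invariant a.e. over the fibres of the domain
  have hρ : ∀ᵐ U ∂(fieldMeasure (F.P K) k (SU N)), (avOfRecord F N K k).avg U ∈ domAltOfRecord F N νD K (k + 1) →
      betaInputOfRecord F N (TβOfRecord₁₃ F N) (chiβOfRecord₁₃Ax F N θ₀) K g k (U.translate (Site.scale a)) =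
        betaInputOfRecord F N (TβOfRecord₁₃ F N) (chiβOfRecord₁₃Ax F N θ₀) K g k U :=
    integrand_comp_ae_eq_on_of_invOn
      (Filter.Eventually.of_forall fun U hU => chiβOfRecord₁₃Ax_translate_of_mem_domAlt' θ₀ νD K g hk' (h11 k (Nat.lt_succ_self k)) a U hU)
      (hsupp k (Nat.lt_succ_self k)) (fun U _ => B12GaugeFixInvariance269.gaugeFixFn_translate FederbushMean.federbushSU hk' a U)
      (fun U hU => hAtr k (Nat.le_succ k) (Site.scale a) U hU) (g k)
  have hTon : ∀ V : GaugeField (F.P K) (k + 1) (SU N), V ∈ domAltOfRecord F N νD K (k + 1) →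
      TβOfRecord₁₃ F N K k (betaInputOfRecord F N (TβOfRecord₁₃ F N) (chiβOfRecord₁₃Ax F N θ₀) K g k) (V.translate a) =
        TβOfRecord₁₃ F N K k (betaInputOfRecord F N (TβOfRecord₁₃ F N) (chiβOfRecord₁₃Ax F N θ₀) K g k) V := fun V hV =>
    TcanOfRecord_translate_of_mem_regSet_inter_of_on hk (hint k (Nat.lt_succ_self k)) a (isOpen_domAltOfRecord νD K (k + 1))
      (fun W => translate_mem_domAltOfRecord_iff K νD (k + 1) a W) hρ ⟨hF7a k (Nat.lt_succ_self k) hV, hV⟩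
  exact mergedTermT_translate_on F N (TβOfRecord₁₃ F N) (chiβOfRecord₁₃Ax F N θ₀) ε g hk' a hTon hAg
    (fun U hU => (translate_mem_domAltOfRecord_iff K νD k (Site.scale a) U).2 hU) (fun U hU => hAtr k (Nat.le_succ k) (Site.scale a) U hU) hWD hnest hW hu

/-- **[F1′ twin: the small-field DOMAIN family is `domAltOfRecord F · νD K ·` = `{PlaqSmall νD.ε₀}` for a FREE numerics record `νD` (only `νD.ε₀` is read); χ, radii `ν.εreg`∕`εbg`∕`ε₂₉` unchanged]** **`𝓝_{k+1}(c_ρ W) = 𝓝_{k+1}(W)` AT THE RE-CENTRED RECORD for `W ∈ domAlt_{k+1}`** (`k + 1 ≤ K`), from the same displayed rows (with [B11] at `W`, `c_ρ W`).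
[cite: Balaban1987RG1, (1.6) p.261, (2.17)-(2.18) p.269, p.263, (1.2) p.260; Balaban1985Variational, Thm 1 p.279] -/
theorem mergedTermT_creflect_on_recordAx' (ε : ℝ) {k : ℕ} (hk : k + 1 ≤ K) (ρ : Fin (F.P K).d)
    (h11 : ∀ j < k + 1, ∀ W ∈ domAltOfRecord F N νD K (j + 1), UkExists F N K (j + 1) θ₀.ν.εreg W ∧ UniqueUkOrbit F N K (j + 1) θ₀.ν.εreg W)
    (hF7a : ∀ j < k + 1, domAltOfRecord F N νD K (j + 1) ⊆
      regSetOfRecord F N K j (betaInputOfRecord F N (TβOfRecord₁₃ F N) (chiβOfRecord₁₃Ax F N θ₀) K g j))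
    (hsupp : ∀ j < k + 1, ∀ᵐ U ∂(fieldMeasure (F.P K) j (SU N)), (avOfRecord F N K j).avg U ∈ domAltOfRecord F N νD K (j + 1) →
      U ∉ domAltOfRecord F N νD K j → chiβOfRecord₁₃Ax F N θ₀ K g j U = 0)
    (hint : ∀ j < k + 1, Integrable (betaInputOfRecord F N (TβOfRecord₁₃ F N) (chiβOfRecord₁₃Ax F N θ₀) K g j) (fieldMeasure (F.P K) j (SU N)))
    {W : GaugeField (F.P K) (k + 1) (SU N)} (hWD : W ∈ domAltOfRecord F N νD K (k + 1))
    (hnest : Averaging.iter (avOfRecord F N K) k (Uk F N K (k + 1) ε W) ∈ domAltOfRecord F N νD K k)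
    (hW : UkExists F N K (k + 1) ε W) (hu : UniqueUkOrbit F N K (k + 1) ε (W.creflect ρ)) :
    mergedTermT F N (TβOfRecord₁₃ F N) (chiβOfRecord₁₃Ax F N θ₀) ε K g k (W.creflect ρ) =
      mergedTermT F N (TβOfRecord₁₃ F N) (chiβOfRecord₁₃Ax F N θ₀) ε K g k W := by
  have hk' : k + 1 ≤ (F.P K).m + (F.P K).K := hk.trans (by simp only [T4Continuum.T4Family.P_K]; omega)
  have hAr := invOn_effActionHT_recordAx_creflect' θ₀ νD K g hk ρ h11 hF7a hsupp hint
  have hAg : ∀ (w : GaugeTransf (F.P K) k (SU N)) (U : GaugeField (F.P K) k (SU N)), U ∈ domAltOfRecord F N νD K k →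
      effActionHT F N (TβOfRecord₁₃ F N) (chiβOfRecord₁₃Ax F N θ₀) K g k (gaugeAct w U) = effActionHT F N (TβOfRecord₁₃ F N) (chiβOfRecord₁₃Ax F N θ₀) K g k U := by
    intro w U hU
    have hχreg : ∀ i, i + 1 < k + 1 → ∀ᵐ U ∂(fieldMeasure (F.P K) (i + 1) (SU N)),
        (avOfRecord F N K (i + 1)).avg U ∈ domAltOfRecord F N νD K (i + 2) →
          U ∉ regSetOfRecord F N K i (betaInputOfRecord F N (TβOfRecord₁₃ F N) (chiβOfRecord₁₃Ax F N θ₀) K g i) ∩ domAltOfRecord F N νD K (i + 1) →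
            chiβOfRecord₁₃Ax F N θ₀ K g (i + 1) U = 0 := fun i hi =>
      (hsupp (i + 1) hi).mono fun U h hS hD => h hS fun hU' => hD ⟨hF7a i (by omega) hU', hU'⟩
    have hA := invOn_effActionHT_recordAx_of_stepsOn' θ₀ νD K g hk h11 hχreg hint k (Nat.le_succ k) w U
    cases k with
    | zero => exact hA (Set.mem_univ _)
    | succ i => exact hA ⟨hF7a i (by omega) hU, hU⟩
  have hρ : ∀ᵐ U ∂(fieldMeasure (F.P K) k (SU N)), (avOfRecord F N K k).avg U ∈ domAltOfRecord F N νD K (k + 1) →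
      betaInputOfRecord F N (TβOfRecord₁₃ F N) (chiβOfRecord₁₃Ax F N θ₀) K g k (U.creflect ρ) =
        betaInputOfRecord F N (TβOfRecord₁₃ F N) (chiβOfRecord₁₃Ax F N θ₀) K g k U :=
    integrand_comp_ae_eq_on_of_invOn
      (Filter.Eventually.of_forall fun U hU => chiβOfRecord₁₃Ax_creflect_of_mem_domAlt' θ₀ νD K g hk' (h11 k (Nat.lt_succ_self k)) ρ U hU)
      (hsupp k (Nat.lt_succ_self k)) (fun U _ => B12GaugeFixInvariance269.gaugeFixFn_creflect FederbushMean.federbushSU hk' ρ U)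
      (fun U hU => hAr k (Nat.le_succ k) U hU) (g k)
  have hTon : ∀ V : GaugeField (F.P K) (k + 1) (SU N), V ∈ domAltOfRecord F N νD K (k + 1) →
      TβOfRecord₁₃ F N K k (betaInputOfRecord F N (TβOfRecord₁₃ F N) (chiβOfRecord₁₃Ax F N θ₀) K g k) (V.creflect ρ) =
        TβOfRecord₁₃ F N K k (betaInputOfRecord F N (TβOfRecord₁₃ F N) (chiβOfRecord₁₃Ax F N θ₀) K g k) V := fun V hV =>
    TcanOfRecord_creflect_of_mem_regSet_inter_of_on hk (hint k (Nat.lt_succ_self k)) ρ (isOpen_domAltOfRecord νD K (k + 1))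
      (fun W => creflect_mem_domAltOfRecord_iff K νD (k + 1) ρ W) hρ ⟨hF7a k (Nat.lt_succ_self k) hV, hV⟩
  exact mergedTermT_creflect_on F N (TβOfRecord₁₃ F N) (chiβOfRecord₁₃Ax F N θ₀) ε g hk' ρ hTon hAg
    (fun U hU => (creflect_mem_domAltOfRecord_iff K νD k ρ U).2 hU) (fun U hU => hAr k (Nat.le_succ k) U hU) hWD hnest hW hu

end Rows

end Summit.QuantumFields.YangMills.Theorems.BalabanUVNodesPortS1

end
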